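import Literature.AlgebraicGeometry.Frobenioids.IrreducibleMorphismsRevised
import Literature.AlgebraicGeometry.Frobenioids.IrreducibleMorphismsPreSteps
import Literature.AlgebraicGeometry.Frobenioids.EquivalenceTransport
import Literature.AlgebraicGeometry.Frobenioids.EquivalenceTransportAnchors
import Literature.AlgebraicGeometry.Frobenioids.EquivalencePreStepsQuasiIsotropic
import HarnessLib

/-!
# Frobenioids I, Theorem 3.4 (ii), pre-steps: the printed route, over bases of FSMFF-type (revised)

Mochizuki, *The geometry of Frobenioids I: the general theory*, Kyushu J. Math. **62** (2008)
293–400, Thm. 3.4 (ii), kurims p. 62, and its proof, p. 63 [cite: MochizukiFrdI2008, Thm. 3.4 (ii) p.63]: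

> "(ii) Suppose that `C₁`, `C₂` are of quasi-isotropic type, and that `D₁`, `D₂` are of FSMFF-type.
> Then `Ψ` preserves pre-steps, co-angular pre-steps, and group-like objects." — proof, p. 63:
> "… we reduce immediately to the case where `C₁`, `C₂` are of isotropic type. Then [since any
> equivalence of categories manifestly preserves FSM-morphisms and irreducible morphisms] the fact
> that `Ψ` preserves pre-steps follows formally from Proposition 1.14, (ii), (iii)."

With Prop. 1.14 (iii) AS PRINTED in 2008 this route fails inside the theorem's scope (the
"⟸" of (iii) is false for the standard Frobenioid; cell record PR-1, `IrreducibleMorphismsCounterexample.lean`),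
and the cell's repair programme (seat abc-iut-L1-t13, `EquivalencePreStepsFSMType.lean`,
`EquivalencePreStepsQuasiIsotropic.lean`) proved Thm. 3.4 (ii) by a different route over bases of
FSM-type. The AUTHOR'S REVISION (*Comments on "The geometry of Frobenioids I"*, January 2024, item
(28) [cite: MochizukiFrdIComments2024, (28) pp.3-4]) replaces both condition (b) of "FSMFF-type" and
the statement of Prop. 1.14 (iii); the revised (iii) is PROVED in `IrreducibleMorphismsRevised.lean`.
This PROOF-ONLY file (seat abc-iut-L1-t11) runs the PRINTED ROUTE with the revised ingredients and
obtains the ISOTROPIC CORE of Thm. 3.4 (ii) for pre-steps over bases of FSMFF-type IN THE REVISED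
SENSE (`IsOfFSMFFType2024`):

* `FrdI.not_isPreStep_inverse_map_of_isIrreducibleHom`: `Ψ⁻¹` carries irreducible non-pre-steps of
  `C₂` to non-pre-steps of `C₁` — because the revised criterion of Prop. 1.14 (iii) ("if `φ` is FSM,
  the composites `αₙ ∘ ⋯ ∘ α₁ = ψ ∘ φ` with `α₁`, `ψ` irreducible and `α₂, …, αₙ` FSMI have bounded
  length") is phrased in terms preserved and reflected by equivalences (FSM-morphisms, irreducible
  morphisms, FSMI-morphisms, composites: `IsFSMIChain.map_equivalence`,
  `IsHeadedFSMIChain.map_equivalence`);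
* `FrdI.isPreStep_map_of_isOfFSMFFType2024`: for Frobenioids `C₁`, `C₂` of isotropic type over
  `D₁`, `D₂` of FSMFF-type (revised) and an equivalence `Ψ : C₁ ⥲ C₂`, `Ψ` maps pre-steps to pre-steps
  — by Prop. 1.14 (ii) in `C₁` ("pre-step ⟺ FSM and mid-adjoint to the irreducible non-pre-steps",
  `PreFrobenioid.isPreStep_iff_isFSM_and_isMidAdjoint`), transport of mid-adjointness
  (`IsMidAdjoint.map_equivalence`, seat abc-iut-L1-t13), the previous bullet, and Prop. 1.14 (ii)
  in `C₂`.

* `FrdI.thm34ii_isotropic_of_isOfFSMFFType2024`: with the group-like clause (core applied to `Ψ⁻¹`,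
  "group-like ⟺ every pre-step out of the object is invertible", seat abc-iut-L1-t13's
  `isGroupLikeObj_iff_preSteps_isIso`) and the co-angular clause (automatic in isotropic type) —
  all three clauses of Thm. 3.4 (ii) in the isotropic case over bases of FSMFF-type (revised).

The reduction of the quasi-isotropic case to this core (p. 63, first sentence; carried out for the
FSM-type core in `EquivalencePreStepsQuasiIsotropic.lean`) is not repeated here. Nothing is asserted about the 2008 wording (`FrdI.Thm34ii` stays typed as printed);
no statement of the paper is strengthened.
-/

set_option backward.isDefEq.respectTransparency false

namespace Literature.AlgebraicGeometry.Frobenioids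

open CategoryTheory Opposite

universe w v v' u u' v₁ v₂ u₁ u₂

/-! ### Irreducible arrows and isomorphisms -/

section IsoAbsorb

variable {C : Type u₁} [Category.{v₁} C]

/-- An irreducible arrow precomposed with an isomorphism is irreducible.
[cite: MochizukiFrdI2008, §0 p.17] -/
theorem IsIrreducibleHom.isoHom_comp {A' A B : C} {f : A ⟶ B} (hf : IsIrreducibleHom f) (i : A' ⟶ A)
    [IsIso i] : IsIrreducibleHom (i ≫ f) :=
  IsIrreducibleHom.of_arrow_iso (asIso i).symm (Iso.refl B) (by simp) hf

/-- An arrow is irreducible if it becomes irreducible after precomposition with an isomorphism.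
[cite: MochizukiFrdI2008, §0 p.17] -/
theorem IsIrreducibleHom.of_isoHom_comp {A' A B : C} {f : A ⟶ B} (i : A' ⟶ A) [IsIso i]
    (h : IsIrreducibleHom (i ≫ f)) : IsIrreducibleHom f :=
  IsIrreducibleHom.of_arrow_iso (asIso i) (Iso.refl B) (by simp) h

/-- A composite with irreducible head and FSMI tail absorbs an isomorphism on the left into its head.
[cite: MochizukiFrdIComments2024, (28) p.3] -/
theorem IsHeadedFSMIChain.of_isoHom_comp {A' A B : C} (i : A' ⟶ A) [IsIso i] {g : A ⟶ B}
    {f : A' ⟶ B} {n : ℕ} (hf : f = i ≫ g)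
    (h : IsHeadedFSMIChain (fun _ _ k => IsIrreducibleHom k) f n) :
    IsHeadedFSMIChain (fun _ _ k => IsIrreducibleHom k) g n := by
  cases h with
  | single f hf' =>
    subst hf
    exact IsHeadedFSMIChain.single _ (IsIrreducibleHom.of_isoHom_comp i hf')
  | comp φ₁ χ m hφ₁ hχ =>
    have hg : g = (inv i ≫ φ₁) ≫ χ := by
      rw [Category.assoc, hf, IsIso.inv_hom_id_assoc]
    rw [hg]
    exact IsHeadedFSMIChain.comp _ _ m (hφ₁.isoHom_comp (inv i)) hχ

/-- An FSM-morphism conjugated by isomorphisms is an FSM-morphism; here: stripping them off.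
[cite: MochizukiFrdI2008, §0 p.14] -/
theorem IsFSM.of_isoHom_comp_isoHom {X' X Y Y' : C} (i : X' ⟶ X) [IsIso i] {β : X ⟶ Y} (j : Y ⟶ Y')
    [IsIso j] (h : IsFSM (i ≫ β ≫ j)) : IsFSM β := by
  have h1 : IsFSM (i ≫ β) := by
    rw [← Category.assoc] at h
    exact IsFSM.of_comp_mono h
  have h2 : IsFSM (inv i ≫ i ≫ β) := (IsFSM.of_isIso (inv i)).comp h1
  rwa [IsIso.inv_hom_id_assoc] at h2

end IsoAbsorb

/-! ### Transport of composites of FSMI-morphisms along an equivalence -/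

section Transport

variable {C₁ : Type u₁} [Category.{v₁} C₁] {C₂ : Type u₂} [Category.{v₂} C₂] (e : C₁ ≌ C₂)

/-- An equivalence carries a composite of `n` FSMI-morphisms to a composite of `n` FSMI-morphisms
("any equivalence of categories manifestly preserves FSM-morphisms and irreducible morphisms",
p. 63). [cite: MochizukiFrdI2008, Thm. 3.4 proof p.63] -/
theorem IsFSMIChain.map_equivalence {A B : C₁} {φ : A ⟶ B} {n : ℕ} (h : IsFSMIChain φ n) :
    IsFSMIChain (e.functor.map φ) n := by
  induction h with
  | single φ hφ => exact IsFSMIChain.single _ (hφ.map_equivalence e)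
  | cons ψ χ n hψ _ ih =>
    rw [Functor.map_comp]
    exact IsFSMIChain.cons _ _ n (hψ.map_equivalence e) ih

/-- An equivalence carries a composite with irreducible head and FSMI tail to a composite of the same
shape and length. [cite: MochizukiFrdI2008, Thm. 3.4 proof p.63] -/
theorem IsHeadedFSMIChain.map_equivalence {A B : C₁} {φ : A ⟶ B} {n : ℕ}
    (h : IsHeadedFSMIChain (fun _ _ k => IsIrreducibleHom k) φ n) :
    IsHeadedFSMIChain (fun _ _ k => IsIrreducibleHom k) (e.functor.map φ) n := by
  cases h with
  | single φ hφ => exact IsHeadedFSMIChain.single _ (hφ.map_equivalence e)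
  | comp φ₁ χ m hφ₁ hχ =>
    rw [Functor.map_comp]
    exact IsHeadedFSMIChain.comp _ _ m (hφ₁.map_equivalence e) (hχ.map_equivalence e)

end Transport

/-! ### Theorem 3.4 (ii), pre-steps, isotropic case, bases of FSMFF-type (revised) -/

namespace FrdI

section Two

variable {D₁ : Type u} [Category.{v} D₁] {Φ₁ : D₁ᵒᵖ ⥤ CommMonCat.{w}} {C₁ : Type u'}
  [Category.{v'} C₁] {D₂ : Type u} [Category.{v} D₂] {Φ₂ : D₂ᵒᵖ ⥤ CommMonCat.{w}} {C₂ : Type u'}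
  [Category.{v'} C₂] {F₁ : C₁ ⥤ ElemFrobenioid Φ₁} {F₂ : C₂ ⥤ ElemFrobenioid Φ₂}

/-- The revised criterion of Prop. 1.14 (iii) is transported by an equivalence: if an irreducible
`β` of `C₂` satisfies it, so does `Ψ⁻¹(β)` in `C₁` (same bound `N`; the composites
`αₙ ∘ ⋯ ∘ α₁ = ψ ∘ Ψ⁻¹(β)` of `C₁` are carried by `Ψ` to composites of the same shape ending in
`Ψ(ψ) ∘ Ψ(Ψ⁻¹ β) ≅ Ψ(ψ) ∘ β`). [cite: MochizukiFrdI2008, Thm. 3.4 proof p.63] -/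
theorem headedChains_bounded_inverse_map (Ψ : C₁ ≌ C₂) {X Y : C₂} {β : X ⟶ Y}
    (hcond : IsFSM β → ∃ N : ℕ, ∀ ⦃Y' : C₂⦄ (ψ : Y ⟶ Y') (n : ℕ), IsIrreducibleHom ψ →
      IsHeadedFSMIChain (fun _ _ k => IsIrreducibleHom k) (β ≫ ψ) n → n ≤ N) :
    IsFSM (Ψ.inverse.map β) → ∃ N : ℕ, ∀ ⦃Z : C₁⦄ (ψ : Ψ.inverse.obj Y ⟶ Z) (n : ℕ),
      IsIrreducibleHom ψ →
        IsHeadedFSMIChain (fun _ _ k => IsIrreducibleHom k) (Ψ.inverse.map β ≫ ψ) n → n ≤ N := by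
  intro hfsm₁
  -- `β ≅ Ψ(Ψ⁻¹ β)` is an FSM-morphism
  have hfsmβ : IsFSM β := by
    have h := hfsm₁.map_equivalence Ψ
    rw [Ψ.fun_inv_map] at h
    exact IsFSM.of_isoHom_comp_isoHom (Ψ.counit.app X) (Ψ.counitInv.app Y) h
  obtain ⟨N, hN⟩ := hcond hfsmβ
  refine ⟨N, fun Z ψ n hψ hch => ?_⟩
  have hch₂ := hch.map_equivalence Ψ
  rw [Functor.map_comp, Ψ.fun_inv_map, Category.assoc, Category.assoc] at hch₂
  exact hN _ n ((hψ.map_equivalence Ψ).isoHom_comp (Ψ.counitInv.app Y))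
    (IsHeadedFSMIChain.of_isoHom_comp (Ψ.counit.app X) rfl hch₂)

/-- In Frobenioids of isotropic type over bases of FSMFF-type (revised), `Ψ⁻¹` carries every
irreducible NON-pre-step of `C₂` to a NON-pre-step of `C₁` — Prop. 1.14 (iii), revised, in `C₂` and
in `C₁`, and transport of its criterion. [cite: MochizukiFrdI2008, Thm. 3.4 proof p.63] -/
theorem not_isPreStep_inverse_map_of_isIrreducibleHom (hF₁ : PreFrobenioid.IsFrobenioid F₁)
    (hF₂ : PreFrobenioid.IsFrobenioid F₂) (hist₁ : PreFrobenioid.IsOfIsotropicType F₁)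
    (hist₂ : PreFrobenioid.IsOfIsotropicType F₂) (hD₁ : IsOfFSMFFType2024 D₁)
    (hD₂ : IsOfFSMFFType2024 D₂) (Ψ : C₁ ≌ C₂) {X Y : C₂} {β : X ⟶ Y} (hβ : IsIrreducibleHom β)
    (hnps : ¬ PreFrobenioid.IsPreStep F₂ β) : ¬ PreFrobenioid.IsPreStep F₁ (Ψ.inverse.map β) := by
  have hβ₁ : IsIrreducibleHom (Ψ.inverse.map β) := hβ.map_equivalence Ψ.symm
  rw [PreFrobenioid.not_isPreStep_iff_headedChains_bounded F₁ hF₁ hist₁ hD₁ hβ₁]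
  exact headedChains_bounded_inverse_map Ψ
    ((PreFrobenioid.not_isPreStep_iff_headedChains_bounded F₂ hF₂ hist₂ hD₂ hβ).mp hnps)

/-- **Thm. 3.4 (ii), pre-steps — isotropic case, bases of FSMFF-type in the revised (2024) sense**, by
the printed route (p. 63): for Frobenioids `C₁`, `C₂` of isotropic type over base categories
`D₁`, `D₂` of FSMFF-type (revised) and an equivalence `Ψ : C₁ ⥲ C₂`, `Ψ` maps pre-steps to
pre-steps — "follows formally from Proposition 1.14, (ii), (iii)" [with (iii) as revised by the
author]. [cite: MochizukiFrdI2008, Thm. 3.4 (ii) p.63] [cite: MochizukiFrdIComments2024, (28) pp.3-4] -/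
theorem isPreStep_map_of_isOfFSMFFType2024 (hF₁ : PreFrobenioid.IsFrobenioid F₁)
    (hF₂ : PreFrobenioid.IsFrobenioid F₂) (hist₁ : PreFrobenioid.IsOfIsotropicType F₁)
    (hist₂ : PreFrobenioid.IsOfIsotropicType F₂) (hD₁ : IsOfFSMFFType2024 D₁)
    (hD₂ : IsOfFSMFFType2024 D₂) (Ψ : C₁ ≌ C₂) {A B : C₁} {φ : A ⟶ B}
    (hφ : PreFrobenioid.IsPreStep F₁ φ) : PreFrobenioid.IsPreStep F₂ (Ψ.functor.map φ) := by
  obtain ⟨hfsm, hmid⟩ := hφ.isFSM_and_isMidAdjoint F₁ hF₁ hist₁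
  refine PreFrobenioid.isPreStep_of_isFSM_isMidAdjoint F₂ hF₂ hist₂ hD₂.isOfFSMFFType
    (hfsm.map_equivalence Ψ) ?_
  refine IsMidAdjoint.map_equivalence Ψ
    (S₁ := fun _ _ ψ => IsIrreducibleHom ψ ∧ ¬ PreFrobenioid.IsPreStep F₁ ψ)
    (S₂ := fun _ _ ψ => IsIrreducibleHom ψ ∧ ¬ PreFrobenioid.IsPreStep F₂ ψ) (fun X Y β hβ => ?_) hmid
  exact ⟨hβ.1.map_equivalence Ψ.symm,
    not_isPreStep_inverse_map_of_isIrreducibleHom hF₁ hF₂ hist₁ hist₂ hD₁ hD₂ Ψ hβ.1 hβ.2⟩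

/-- The same with `Ψ⁻¹`: pre-steps of `C₂` go to pre-steps of `C₁`; hence `Ψ` preserves AND reflects
pre-steps. [cite: MochizukiFrdI2008, Thm. 3.4 (ii) p.63] -/
theorem isPreStep_map_iff_of_isOfFSMFFType2024 (hF₁ : PreFrobenioid.IsFrobenioid F₁)
    (hF₂ : PreFrobenioid.IsFrobenioid F₂) (hist₁ : PreFrobenioid.IsOfIsotropicType F₁)
    (hist₂ : PreFrobenioid.IsOfIsotropicType F₂) (hD₁ : IsOfFSMFFType2024 D₁)
    (hD₂ : IsOfFSMFFType2024 D₂) (Ψ : C₁ ≌ C₂) {A B : C₁} (φ : A ⟶ B) :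
    PreFrobenioid.IsPreStep F₂ (Ψ.functor.map φ) ↔ PreFrobenioid.IsPreStep F₁ φ := by
  refine ⟨fun h => ?_, isPreStep_map_of_isOfFSMFFType2024 hF₁ hF₂ hist₁ hist₂ hD₁ hD₂ Ψ⟩
  have h1 := isPreStep_map_of_isOfFSMFFType2024 hF₂ hF₁ hist₂ hist₁ hD₂ hD₁ Ψ.symm h
  -- `Ψ⁻¹ Ψ φ = η_A⁻¹ ∘ φ ∘ η_B`: strip the unit isomorphisms (pre-steps absorb isomorphisms)
  have h2 : PreFrobenioid.IsPreStep F₁ (Ψ.unitInv.app A ≫ φ ≫ Ψ.unit.app B) := by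
    have := h1
    rw [show Ψ.symm.functor.map (Ψ.functor.map φ) = Ψ.inverse.map (Ψ.functor.map φ) from rfl,
      Ψ.inv_fun_map] at this
    exact this
  have hP₁ := hF₁.isPreFrobenioid
  have h3 : PreFrobenioid.IsPreStep F₁ (φ ≫ Ψ.unit.app B) := by
    have h4 := PreFrobenioid.IsPreStep.comp F₁ (PreFrobenioid.isPreStep_of_isIso F₁ (Ψ.unit.app A)) h2
    rwa [Iso.hom_inv_id_app_assoc] at h4
  have h5 := PreFrobenioid.IsPreStep.comp F₁ h3 (PreFrobenioid.isPreStep_of_isIso F₁ (Ψ.unitInv.app B))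
  simpa using h5

/-- **`Ψ` preserves group-like objects** — isotropic type, bases of FSMFF-type (revised): apply the
pre-step core to `Ψ⁻¹` and use "group-like ⟺ every pre-step out of the object is invertible"
(`isGroupLikeObj_iff_preSteps_isIso`, seat abc-iut-L1-t13). [cite: MochizukiFrdI2008, Thm. 3.4 (ii) p.62] -/
theorem isGroupLikeObj_map_of_isOfFSMFFType2024 (hF₁ : PreFrobenioid.IsFrobenioid F₁)
    (hF₂ : PreFrobenioid.IsFrobenioid F₂) (hist₁ : PreFrobenioid.IsOfIsotropicType F₁)
    (hist₂ : PreFrobenioid.IsOfIsotropicType F₂) (hD₁ : IsOfFSMFFType2024 D₁)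
    (hD₂ : IsOfFSMFFType2024 D₂) (Ψ : C₁ ≌ C₂) {A : C₁} (hA : PreFrobenioid.IsGroupLikeObj F₁ A) :
    PreFrobenioid.IsGroupLikeObj F₂ (Ψ.functor.obj A) := by
  rw [isGroupLikeObj_iff_preSteps_isIso hF₂ hist₂]
  intro B' φ' hφ'
  have hρ : PreFrobenioid.IsPreStep F₁ (Ψ.inverse.map φ') :=
    isPreStep_map_of_isOfFSMFFType2024 hF₂ hF₁ hist₂ hist₁ hD₂ hD₁ Ψ.symm hφ'
  have h1 : PreFrobenioid.IsPreStep F₁ (Ψ.unit.app A ≫ Ψ.inverse.map φ') :=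
    PreFrobenioid.IsPreStep.comp F₁ (PreFrobenioid.isPreStep_of_isIso F₁ _) hρ
  haveI : IsIso (Ψ.unit.app A ≫ Ψ.inverse.map φ') :=
    (isGroupLikeObj_iff_preSteps_isIso hF₁ hist₁ A).1 hA _ h1
  haveI : IsIso (Ψ.inverse.map φ') := IsIso.of_isIso_comp_left (Ψ.unit.app A) (Ψ.inverse.map φ')
  exact isIso_of_fully_faithful Ψ.inverse φ'

/-- **Thm. 3.4 (ii) for Frobenioids of ISOTROPIC type over bases of FSMFF-type in the revised (2024)
sense**: `Ψ` preserves pre-steps, co-angular pre-steps and group-like objects (the isotropic case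
to which the printed proof reduces, p. 63; pre-steps by the printed route through Prop. 1.14 (ii),
(iii) [revised]; co-angularity is automatic in isotropic type, Prop. 1.4 (i)).
[cite: MochizukiFrdI2008, Thm. 3.4 (ii) p.62] [cite: MochizukiFrdIComments2024, (28) pp.3-4] -/
theorem thm34ii_isotropic_of_isOfFSMFFType2024 (hF₁ : PreFrobenioid.IsFrobenioid F₁)
    (hF₂ : PreFrobenioid.IsFrobenioid F₂) (hist₁ : PreFrobenioid.IsOfIsotropicType F₁)
    (hist₂ : PreFrobenioid.IsOfIsotropicType F₂) (hD₁ : IsOfFSMFFType2024 D₁)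
    (hD₂ : IsOfFSMFFType2024 D₂) (Ψ : C₁ ≌ C₂) :
    (∀ ⦃A B : C₁⦄ (φ : A ⟶ B), PreFrobenioid.IsPreStep F₁ φ → PreFrobenioid.IsPreStep F₂ (Ψ.functor.map φ)) ∧
      (∀ ⦃A B : C₁⦄ (φ : A ⟶ B), PreFrobenioid.IsCoAngularPreStep F₁ φ →
        PreFrobenioid.IsCoAngularPreStep F₂ (Ψ.functor.map φ)) ∧
      (∀ ⦃A : C₁⦄, PreFrobenioid.IsGroupLikeObj F₁ A → PreFrobenioid.IsGroupLikeObj F₂ (Ψ.functor.obj A)) :=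
  ⟨fun _ _ _ hφ => isPreStep_map_of_isOfFSMFFType2024 hF₁ hF₂ hist₁ hist₂ hD₁ hD₂ Ψ hφ,
    fun _ _ _ hφ => ⟨PreFrobenioid.isCoAngular_of_isIsotropic_codomains F₂ _ (fun Z _ => hist₂ Z),
      isPreStep_map_of_isOfFSMFFType2024 hF₁ hF₂ hist₁ hist₂ hD₁ hD₂ Ψ hφ.2⟩,
    fun _ hA => isGroupLikeObj_map_of_isOfFSMFFType2024 hF₁ hF₂ hist₁ hist₂ hD₁ hD₂ Ψ hA⟩

end Two

end FrdI

end Literature.AlgebraicGeometry.Frobenioids
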